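import Summits.QuantumFields.BalabanUV.Beta.FP.TorusCompositeCovarianceOne
import Summits.QuantumFields.BalabanUV.Beta.FP.TorusCompositeFP

/-!
# `BalabanUV.Beta.FP.TorusCompositeCovarianceOneRows` — road «FP» for binder row D1, ROUTE T, the OWNER d1-p3's SPEC-27 «THE (j, m) TORUS CALL FOR m ≥ 2»,
# **(COV-m) ORDER 1 AT EVERY DEPTH, PART 2 — THE DOOR's ROWS `c1` AND `d1`** of the composite torus call `FP/NestedStepLawTorusCompositeOneShot(Top)`
# (#19 p332996 ∕ #21): with `Q₁₁ := c • compIns₁ Lc M′ lev rs (n+1) h` (PART 1's chain-rule jet), the door's `W₀ = towerGen`, `W₁` VERBATIM (`hW₁`, leaf-06's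
# `evalN` closed form, weight `c·h`), **`Q₁₁ · W₀ + Q₁₀ · W₁ = fromCols D̄₁ 0`** with the coarse jet `D̄₁(a, t̄) = −c · (compRows … (n+1) · h) a · [t̄ = a.1 + e_{a.2}]`
# EXPLICIT (tip-type on every top bond — R-FP-56 (a)'s shape), and **`Q₂₁ · (σ_{n+1} • D̄) + Q₂₀ · D̄₁ = 0`** with `Q₂₁ := Σ_{a′} (c·θ_{n+1}·(compRows · h) a′) •` the top
# step's rooted first-order table in the door's multiplier presentation (the transported direction one level up; `θ_{n+1} = Lc^{d+1}·stepScale d Lc (lev 0) ∕ σ_{n+1}`)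

WHAT.  §1 `towerGen_eq_tgrad_mul_evalN` (leaf-06's tower generators ARE the finest gradient times the point-evaluation matrix of the nested modes at the
finest sites — `towerGen_top_eq` + `tgrad_mul_colSel` down the tower), `evalN_congr` (the evaluation matrix sees points only modulo the finest torus),
**`evalN_itRoot_rootPt`** (every LOWER nested mode VANISHES at the iterated root sites of the top torus's points — roots are not residual parameters,
`tdelta_eq_zero_of_root` + `quo_itRoot`).  §2 **`torus_c1_tower`**: PART 1's all-columns law `compIns₁_mul_tgrad` read through `W₀ = D · evalN`: the tip term
is `−Q₁₀ · W₁` (`evalN_congr`), the far-root term's top block is `D̄₁` (`quo_itRoot`), its lower blocks vanish (§1) — #19 ∕ #21's `c1` BY TERM after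
`rw [hQ₁₁]`.  §3 `sum_smul_vhSAt_mul_tgrad_res` (the top step's weighted first-order table against the top comb's RESIDUAL gauge columns in ANY multiplier
presentation `(pμ′, mμ′)` is the tip contact — my g17 `submatrix_vhSAt_mul_tgrad_of_not_root`), **`torus_d1_tower`** — #19 ∕ #21's `d1` BY TERM after
`rw [hQ₂₁]`, `Dbar := σ_{n+1} • D̄` as in `c0` (my g21 `compRows_mul_towerGen_succ`).  At `n = 0` these are (B)'s p314580 rows with `θ_1 = stepScale (lev 0) ∕
(stepScale (lev 1)·#B)·Lc^{d+1}` — the one-shot door's `θ_j` (my U20 `hQ₂₁`).  [folklore] finite sums BY NAME; no `def`, no `def … : Prop`, nothing cited, 0 sorry.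
Nothing of the dictionary ∕ Bałaban's asserted (the identification of `compIns₁` with Bałaban's composite table is an2's (C1) word, R-D1-g42-4 (3)); ORDER 2
(`c2 d2`, the second chain rule + an1's `vh₂S` two-insertion law) is NOT here.

HONEST DEPENDENCY (page 1, mandatory): continuum YM on T⁴ ⇐ BetaPertH ∧ nine spine estimates (0/9 proved); BetaPertH ⇐ (D1) ∧ (D4) ∧ CAP+tail;
G-an2-4 gates asym, D1 and NE2/3/4.  HONEST FRAMING (cell contract, verbatim): «discharging `BetaPertH` makes Bałaban's UV stability UNCONDITIONAL —
a real constructive-QFT result; it is NOT the continuum limit and NOT the Clay problem.»  ABSOLUTE RULE (cell charter, verbatim): «No internally-minted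
statement may enter as a cited fact. Every hypothesis is either kernel-proved in this package or a verbatim quotation of a PUBLISHED theorem with page
reference. The manuscript(s) under audit are NOT citable for their own disputed steps — they are the thing under adjudication; programme-internal
(2001/route/tribunal) claims are never citable.»  0 estimates; 0∕4 row-D1 binders; NOT (T-ID), NOT SDF, NOT D1, NOT BetaPertH, NOT continuum, NOT Clay.
D1 formalisation swarm LEAF PROVER 02 (b2b-balaban-beta-d1-formalise-leaf-02 gen 22), 2026-08-22.  No existing file touched.
-/

noncomputable section

open scoped BigOperators

namespace Summit.QuantumFields.BalabanUV.Beta.FP.TorusCompositeCovarianceOneRows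

open Matrix Finset
open Literature.Probability.LatticeModels (Torus.proj)
open Literature.MathematicalPhysics.QuantumFieldTheory
open Literature.MathematicalPhysics.QuantumFieldTheory.Balaban1983to89
open Literature.MathematicalPhysics.QuantumFieldTheory.Balaban1983to89.Beta
open B5Prop11Plancherel (fine)
open B6Lemma24Torus (pbox mem_pbox)
open AffineAveraging (Site box toSite unitVec)
open LatticeForm (quo)
open AveragingHessianKernelsRooted (vhSAt)
open OneStepResolventKernel (Fib)
open Summit.QuantumFields.BalabanUV.Beta.BorderedHessian (bhKStepAt stepScale stepScale_ne_zero)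
open Summit.QuantumFields.BalabanUV.Beta.FP.KernelPeriodisationFib (Idx perF)
open Summit.QuantumFields.BalabanUV.Beta.FP.KernelPeriodisationFibLoc (dper)
open Summit.QuantumFields.BalabanUV.Beta.FP.TorusGaugeCovariance (tdelta tdelta_congr tdelta_eq_zero_of_root tgrad)
open Summit.QuantumFields.BalabanUV.Beta.FP.TorusGaugeCovariancePairing (wrapPt wrapPt_coe wrapPt_of_mem tdelta_eq_ite_wrapPt)
open Summit.QuantumFields.BalabanUV.Beta.FP.TorusGaugeCovarianceCoarse (tgradBlock coarsePt coarsePt_coe proj_coarsePt tdelta_quo_congr)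
open Summit.QuantumFields.BalabanUV.Beta.FP.TorusCombRows (Res ne_rootOf_iff_proj_ne)
open Summit.QuantumFields.BalabanUV.Beta.GAN24.FineReadoutCauchyFrame (toSite_mem_range)
open Summit.QuantumFields.BalabanUV.Beta.FP.PeriodisedBorderWardContact (submatrix_vhSAt_mul_tgrad_of_not_root)
open Summit.QuantumFields.BalabanUV.Beta.FP.TorusCompositeObjects
open Summit.QuantumFields.BalabanUV.Beta.FP.TorusCompositeCovariance (rootPt rootPt_coe itRoot itRoot_zero itRoot_succ quo_itRoot towerGen_top_eq tgrad_mul_colSel)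
open Summit.QuantumFields.BalabanUV.Beta.FP.TorusCompositeFP (evalN evalN_zero evalN_succ)
open Summit.QuantumFields.BalabanUV.Beta.FP.TorusCompositeCovarianceOne (tdelta_wrapPt of_tdelta_mul compIns₁ compIns₁_mul_tgrad prod_stepScale_mul_card_ne_zero')

variable {d : ℕ} (Lc : ℕ) [NeZero Lc]

/-! ## §1 The tower generators through the point-evaluation matrix; lower modes vanish at the iterated roots -/

/-- [folklore] **leaf-06's TOWER GENERATORS ARE THE FINEST GRADIENT TIMES THE POINT-EVALUATION MATRIX OF THE NESTED MODES AT THE FINEST SITES**: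
`towerGen Lc M rs n = D_finest · evalN Lc M rs n (·)` (depth `0`: `tgrad_mul_colSel`; top block: my g21 `towerGen_top_eq`; lower block: the tower below). -/
theorem towerGen_eq_tgrad_mul_evalN :
    ∀ (n : ℕ) (M : Fin (d + 1) → ℕ) [∀ μ, NeZero (M μ)] (rs : ℕ → (Fin (d + 1) → ℕ)),
      towerGen Lc M rs n
        = (tgrad (towerTorus Lc M n)).submatrix
              (fun b : ↥(pbox (towerTorus Lc M n)) × Fin (d + 1) => ((b.1, Sum.inl b.2) : Idx (towerTorus Lc M n) (Fib d))) id
            * evalN Lc M rs n (fun s : ↥(pbox (towerTorus Lc M n)) => (s : Site (d + 1)))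
  | 0, M, _, rs => by
    show (tgrad M).submatrix (fun b : ↥(pbox M) × Fin (d + 1) => ((b.1, Sum.inl b.2) : Idx M (Fib d))) (fun t : Res (toSite (rs 0)) Lc M => (t.1 : ↥(pbox M)))
      = (tgrad M).submatrix (fun b : ↥(pbox M) × Fin (d + 1) => ((b.1, Sum.inl b.2) : Idx M (Fib d))) id
          * Matrix.of (fun (s : ↥(pbox M)) (t : Res (toSite (rs 0)) Lc M) => tdelta M (s : Site (d + 1)) t.1)
    rw [← tgrad_mul_colSel (Lc := Lc) M (rs 0)]
    congr 1
    ext u t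
    rw [Matrix.of_apply, Matrix.of_apply, tdelta_eq_ite_wrapPt, wrapPt_of_mem]
  | n + 1, M, _, rs => by
    show Matrix.fromCols
          ((tgradBlock M (bigRatio Lc n)).submatrix
            (fun b : ↥(pbox (towerTorus Lc (fine Lc M) n)) × Fin (d + 1) =>
              ((pboxCongr (towerTorus_fine_eq_fine Lc M n) b.1, Sum.inl b.2) : Idx (fine (bigRatio Lc n) M) (Fib d)))
            (fun t : Res (toSite (rs 0)) Lc M => (t.1 : ↥(pbox M))))
          (towerGen Lc (fine Lc M) (fun k => rs (k + 1)) n)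
      = (tgrad (towerTorus Lc (fine Lc M) n)).submatrix
            (fun b : ↥(pbox (towerTorus Lc (fine Lc M) n)) × Fin (d + 1) => ((b.1, Sum.inl b.2) : Idx (towerTorus Lc (fine Lc M) n) (Fib d))) id
          * Matrix.fromCols
              (Matrix.of fun (s : ↥(pbox (towerTorus Lc (fine Lc M) n))) (t : Res (toSite (rs 0)) Lc M) => tdelta M (quo (bigRatio Lc n) (s : Site (d + 1))) t.1)
              (evalN Lc (fine Lc M) (fun k => rs (k + 1)) n (fun s : ↥(pbox (towerTorus Lc (fine Lc M) n)) => (s : Site (d + 1))))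
    rw [Matrix.mul_fromCols, towerGen_top_eq, towerGen_eq_tgrad_mul_evalN n (fine Lc M) (fun k => rs (k + 1))]

/-- [folklore] **THE POINT-EVALUATION MATRIX SEES ITS POINTS ONLY MODULO THE FINEST TORUS** (`tdelta_congr ∕ tdelta_quo_congr` down the tower). -/
theorem evalN_congr :
    ∀ (n : ℕ) (M : Fin (d + 1) → ℕ) [∀ μ, NeZero (M μ)] (rs : ℕ → (Fin (d + 1) → ℕ)) {β β' : Type*} (y : β → Site (d + 1)) (y' : β' → Site (d + 1))
      (b : β) (b' : β') (_hy : ∀ i, ((towerTorus Lc M n i : ℕ) : ℤ) ∣ y b i - y' b' i) (e : NParam Lc M rs n),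
      evalN Lc M rs n y b e = evalN Lc M rs n y' b' e
  | 0, M, _, rs, β, β', y, y', b, b', hy, t => by
    show tdelta M (y b) t.1 = tdelta M (y' b') t.1
    exact tdelta_congr M hy t.1
  | n + 1, M, _, rs, β, β', y, y', b, b', hy, Sum.inl t => by
    show tdelta M (quo (bigRatio Lc n) (y b)) t.1 = tdelta M (quo (bigRatio Lc n) (y' b')) t.1
    haveI : NeZero (bigRatio Lc n) := ⟨(bigRatio_pos Lc (Nat.pos_of_ne_zero (NeZero.ne Lc)) n).ne'⟩
    refine tdelta_quo_congr M (bigRatio Lc n) (fun i => ?_) t.1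
    have h := hy i
    rw [towerTorus_apply, ← bigRatio_eq_pow, Nat.cast_mul] at h
    exact h
  | n + 1, M, _, rs, β, β', y, y', b, b', hy, Sum.inr e => by
    show evalN Lc (fine Lc M) (fun k => rs (k + 1)) n y b e = evalN Lc (fine Lc M) (fun k => rs (k + 1)) n y' b' e
    exact evalN_congr n (fine Lc M) (fun k => rs (k + 1)) y y' b b' hy e

variable {Lc} in
/-- [folklore] a ROOT site `Lc•u + ρ` of the fine torus is not a residual parameter of the comb rooted at `ρ`: `[rootPt u = t̄] = 0` for `t̄ ∈ Res ρ`. -/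
theorem tdelta_rootPt_res (M : Fin (d + 1) → ℕ) [∀ μ, NeZero (M μ)] {r : Fin (d + 1) → ℕ} (hr : r ∈ box (d + 1) Lc) (u : ↥(pbox M))
    (t : Res (toSite r) Lc (fine Lc M)) : tdelta (fine Lc M) ((rootPt M Lc hr u : ↥(pbox (fine Lc M))) : Site (d + 1)) t.1 = 0 := by
  refine tdelta_eq_zero_of_root (fine Lc M) (fun i => ⟨M i, rfl⟩) (ρ := toSite r) ?_
    ((ne_rootOf_iff_proj_ne (Nat.pos_of_ne_zero (NeZero.ne Lc)) (toSite_mem_range hr) _).1 t.2)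
  rw [rootPt_coe, add_sub_cancel_right, ← coarsePt_coe M Lc u]
  exact proj_coarsePt M Lc u

/-- [folklore] **EVERY LOWER NESTED MODE VANISHES AT THE ITERATED ROOT SITES OF THE TOP TORUS's POINTS** (the modes of the tower below `fine Lc M`, evaluated
at `itRoot n (rootPt u)`, `u ∈ pbox M`): each block reads `[quo (Lc^k) (itRoot …) = t̄]` (`quo_itRoot`) with `t̄` a RESIDUAL parameter and the iterated root a
ROOT (`tdelta_rootPt_res`).  This is why the composite `c1`'s right block is `0`. -/
theorem evalN_itRoot_rootPt :
    ∀ (n : ℕ) (M : Fin (d + 1) → ℕ) [∀ μ, NeZero (M μ)] (rs : ℕ → (Fin (d + 1) → ℕ)) (hrs : ∀ k, rs k ∈ box (d + 1) Lc) (u : ↥(pbox M))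
      (e : NParam Lc (fine Lc M) (fun k => rs (k + 1)) n),
      evalN Lc (fine Lc M) (fun k => rs (k + 1)) n (fun s : ↥(pbox (towerTorus Lc (fine Lc M) n)) => (s : Site (d + 1)))
          (itRoot Lc (fine Lc M) (fun k => rs (k + 1)) (fun k => hrs (k + 1)) n (rootPt M Lc (hrs 1) u)) e = 0
  | 0, M, _, rs, hrs, u, t => by
    show tdelta (fine Lc M) ((rootPt M Lc (hrs 1) u : ↥(pbox (fine Lc M))) : Site (d + 1)) t.1 = 0
    exact tdelta_rootPt_res M (hrs 1) u t
  | n + 1, M, _, rs, hrs, u, Sum.inl t => by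
    show tdelta (fine Lc M) (quo (bigRatio Lc n)
        ((itRoot Lc (fine Lc M) (fun k => rs (k + 1)) (fun k => hrs (k + 1)) (n + 1) (rootPt M Lc (hrs 1) u) : ↥(pbox (towerTorus Lc (fine Lc M) (n + 1)))) :
          Site (d + 1))) t.1 = 0
    rw [bigRatio_eq_pow, quo_itRoot]
    exact tdelta_rootPt_res M (hrs 1) u t
  | n + 1, M, _, rs, hrs, u, Sum.inr e => by
    show evalN Lc (fine Lc (fine Lc M)) (fun k => rs (k + 1 + 1)) n (fun s : ↥(pbox (towerTorus Lc (fine Lc (fine Lc M)) n)) => (s : Site (d + 1)))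
        (itRoot Lc (fine Lc (fine Lc M)) (fun k => rs (k + 1 + 1)) (fun k => hrs (k + 1 + 1)) n (rootPt (fine Lc M) Lc (hrs (1 + 1)) (rootPt M Lc (hrs 1) u))) e = 0
    exact evalN_itRoot_rootPt n (fine Lc M) (fun k => rs (k + 1)) (fun k => hrs (k + 1)) (rootPt M Lc (hrs 1) u) e

/-! ## §2 The door's composite covariance row `c1` -/

section Rows

variable (M' : Fin (d + 1) → ℕ) [∀ μ, NeZero (M' μ)] (lev : ℕ → ℕ) (rs : ℕ → (Fin (d + 1) → ℕ))

/-- [folklore] the door's generator jet `W₁` (leaf-06's `evalN` at the TIPS, weight `−c·h`) is `−c •` the tip-contact matrix times the point-evaluation matrix at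
the finest sites (`of_tdelta_mul`, `evalN_congr` along `wrapPt`). -/
theorem W₁_eq_neg_smul_tip_mul_evalN (n : ℕ) (c : ℝ) (h : ↥(pbox (towerTorus Lc M' (n + 1))) × Fin (d + 1) → ℝ) :
    (Matrix.of fun (b : (↥(pbox (towerTorus Lc M' (n + 1))) × Fin (d + 1))) (e : NParam Lc M' rs (n + 1)) =>
        -(c * h b * evalN Lc M' rs (n + 1) (fun b' : (↥(pbox (towerTorus Lc M' (n + 1))) × Fin (d + 1)) => (b'.1 : Site (d + 1)) + unitVec b'.2) b e))
      = -(c • (Matrix.of (fun (b : ↥(pbox (towerTorus Lc M' (n + 1))) × Fin (d + 1)) (s : ↥(pbox (towerTorus Lc M' (n + 1)))) =>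
            h b * tdelta (towerTorus Lc M' (n + 1)) ((b.1 : Site (d + 1)) + unitVec b.2) s)
          * evalN Lc M' rs (n + 1) (fun s : ↥(pbox (towerTorus Lc M' (n + 1))) => (s : Site (d + 1))))) := by
  rw [of_tdelta_mul]
  ext b e
  simp only [Matrix.of_apply, Matrix.neg_apply, Matrix.smul_apply, smul_eq_mul]
  rw [evalN_congr Lc (n + 1) M' rs (fun b' : (↥(pbox (towerTorus Lc M' (n + 1))) × Fin (d + 1)) => (b'.1 : Site (d + 1)) + unitVec b'.2)
    (fun s : ↥(pbox (towerTorus Lc M' (n + 1))) => (s : Site (d + 1))) b (wrapPt (towerTorus Lc M' (n + 1)) ((b.1 : Site (d + 1)) + unitVec b.2))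
    (fun i => B6Lemma24Torus.isPeriod_sub_wrap (M := towerTorus Lc M' (n + 1)) _ i) e]
  ring

/-- [folklore] **`torus_c1_tower` — (COV-m) ORDER 1: THE DOOR's COMPOSITE COVARIANCE ROW `c1` AT EVERY DEPTH.**  With `Q₁₁ := c • compIns₁ Lc M′ lev rs (n+1) h`
(PART 1's chain-rule jet of the composite averaging along `h`, weight `c` = the transport generator's), `W₀ := towerGen …`, `W₁` the door's `hW₁` VERBATIM:
`Q₁₁ · W₀ + Q₁₀ · W₁ = fromCols D̄₁ 0`, `D̄₁(a, t̄) = −c · (compRows … (n+1) · h) a · [t̄ = a.1 + e_{a.2}]` — the composite insertion jet's coarse image is the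
TIP-type jet of the transported direction `compRows · h` on EVERY top bond (R-FP-56 (a)'s shape for `uTop`), and every lower generator is killed.  Proof: PART 1's
all-columns law through `towerGen = D · evalN` (§1); tip term `= −Q₁₀·W₁`; far-root term: top block by `quo_itRoot`, lower blocks by `evalN_itRoot_rootPt`. -/
theorem torus_c1_tower (hrs : ∀ k, rs k ∈ box (d + 1) Lc) (n : ℕ) (c : ℝ) (h : ↥(pbox (towerTorus Lc M' (n + 1))) × Fin (d + 1) → ℝ)
    {W₁ : Matrix (↥(pbox (towerTorus Lc M' (n + 1))) × Fin (d + 1)) (NParam Lc M' rs (n + 1)) ℝ}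
    (hW₁ : W₁ = Matrix.of fun (b : (↥(pbox (towerTorus Lc M' (n + 1))) × Fin (d + 1))) (e : NParam Lc M' rs (n + 1)) =>
      -(c * h b * evalN Lc M' rs (n + 1) (fun b' : (↥(pbox (towerTorus Lc M' (n + 1))) × Fin (d + 1)) => (b'.1 : Site (d + 1)) + unitVec b'.2) b e)) :
    c • compIns₁ Lc M' lev rs (n + 1) h * towerGen Lc M' rs (n + 1) + compRows Lc M' lev rs (n + 1) * W₁
      = Matrix.fromCols
          (Matrix.of fun (a : ↥(pbox M') × Fin (d + 1)) (t : Res (toSite (rs 0)) Lc M') =>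
            -(c * (compRows Lc M' lev rs (n + 1) *ᵥ h) a * tdelta M' ((a.1 : Site (d + 1)) + unitVec a.2) t.1))
          (0 : Matrix (↥(pbox M') × Fin (d + 1)) (NParam Lc (fine Lc M') (fun k => rs (k + 1)) n) ℝ) := by
  -- the far-root contact through the point-evaluation matrix, weighted by `−c`: top block = the coarse jet, lower blocks vanish
  have hfar : -(c • (Matrix.of (fun (a : ↥(pbox M') × Fin (d + 1)) (s : ↥(pbox (towerTorus Lc M' (n + 1)))) =>
        (compRows Lc M' lev rs (n + 1) *ᵥ h) a
          * tdelta (towerTorus Lc M' (n + 1)) ((itRoot Lc M' rs hrs (n + 1) (wrapPt M' ((a.1 : Site (d + 1)) + unitVec a.2)) : ↥(pbox (towerTorus Lc M' (n + 1)))) : Site (d + 1)) s)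
        * evalN Lc M' rs (n + 1) (fun s : ↥(pbox (towerTorus Lc M' (n + 1))) => (s : Site (d + 1)))))
      = Matrix.fromCols
          (Matrix.of fun (a : ↥(pbox M') × Fin (d + 1)) (t : Res (toSite (rs 0)) Lc M') =>
            -(c * (compRows Lc M' lev rs (n + 1) *ᵥ h) a * tdelta M' ((a.1 : Site (d + 1)) + unitVec a.2) t.1))
          (0 : Matrix (↥(pbox M') × Fin (d + 1)) (NParam Lc (fine Lc M') (fun k => rs (k + 1)) n) ℝ) := by
    rw [of_tdelta_mul, evalN_succ]
    ext a e
    rcases e with t | e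
    · simp only [Matrix.neg_apply, Matrix.smul_apply, Matrix.of_apply, Matrix.fromCols_apply_inl, wrapPt_of_mem, smul_eq_mul]
      rw [bigRatio_eq_pow, quo_itRoot, tdelta_wrapPt]
      ring
    · simp only [Matrix.neg_apply, Matrix.smul_apply, Matrix.of_apply, Matrix.fromCols_apply_inr, Matrix.zero_apply, wrapPt_of_mem, smul_eq_mul, itRoot_succ]
      dsimp only [towerTorus_succ]
      rw [evalN_itRoot_rootPt, mul_zero, mul_zero, neg_zero]
  rw [hW₁, W₁_eq_neg_smul_tip_mul_evalN, towerGen_eq_tgrad_mul_evalN Lc (n + 1) M' rs, Matrix.smul_mul, ← Matrix.mul_assoc,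
    compIns₁_mul_tgrad Lc (n + 1) M' lev rs hrs h, ← hfar, Matrix.sub_mul, smul_sub, Matrix.mul_neg, Matrix.mul_smul, ← Matrix.mul_assoc]
  abel

/-! ## §3 The top step's coarse covariance row `d1` along the transported direction -/

variable {Lc M'} in
/-- [folklore] **THE TOP STEP's WEIGHTED FIRST-ORDER TABLE AGAINST THE TOP COMB's RESIDUAL GAUGE COLUMNS IS THE TIP CONTACT**, in ANY multiplier presentation
`k ↦ (pμ′ k, inr (mμ′ k))` (my g17 `submatrix_vhSAt_mul_tgrad_of_not_root`; `Lc ∣ M′`, root `r ∈ box`, any level `ℓ` on the right):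
`(Σ_{a′} v a′ • T^{a′}) · D̄ = c_ℓ • Q₂₀ · (v b · [t̄ = b.1 + e_{b.2}])`. -/
theorem sum_smul_vhSAt_mul_tgrad_res {r : Fin (d + 1) → ℕ} (hr : r ∈ box (d + 1) Lc) (hM' : ∀ i, Lc ∣ M' i) (ℓ : ℕ)
    {κ : Type*} (pμ' : κ → ↥(pbox M')) (mμ' : κ → Fin (d + 1)) (v : ↥(pbox M') × Fin (d + 1) → ℝ) :
    (∑ a' : ↥(pbox M') × Fin (d + 1), v a' •
        (perF M' (dper M' (vhSAt (toSite r) d Lc rfl a'.2 (a'.1 : Site (d + 1))))).submatrix (fun k : κ => ((pμ' k, Sum.inr (mμ' k)) : Idx M' (Fib d)))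
          (fun b : ↥(pbox M') × Fin (d + 1) => ((b.1, Sum.inl b.2) : Idx M' (Fib d))))
        * (tgrad M').submatrix (fun a : ↥(pbox M') × Fin (d + 1) => ((a.1, Sum.inl a.2) : Idx M' (Fib d))) (fun t : Res (toSite r) Lc M' => (t.1 : ↥(pbox M')))
      = ((Lc : ℝ) ^ (d + 1) * stepScale d Lc ℓ)⁻¹ •
          ((perF M' (bhKStepAt d (toSite r) Lc ℓ)).submatrix (fun k : κ => ((pμ' k, Sum.inr (mμ' k)) : Idx M' (Fib d)))
              (fun b : ↥(pbox M') × Fin (d + 1) => ((b.1, Sum.inl b.2) : Idx M' (Fib d)))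
            * Matrix.of (fun (b : ↥(pbox M') × Fin (d + 1)) (t : Res (toSite r) Lc M') => v b * tdelta M' ((b.1 : Site (d + 1)) + unitVec b.2) t.1)) := by
  have hL0 : 0 < Lc := Nat.pos_of_ne_zero (NeZero.ne Lc)
  ext k t
  have key : ∀ a' : ↥(pbox M') × Fin (d + 1),
      ((perF M' (dper M' (vhSAt (toSite r) d Lc rfl a'.2 (a'.1 : Site (d + 1))))).submatrix (fun k : κ => ((pμ' k, Sum.inr (mμ' k)) : Idx M' (Fib d)))
            (fun b : ↥(pbox M') × Fin (d + 1) => ((b.1, Sum.inl b.2) : Idx M' (Fib d)))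
          * (tgrad M').submatrix (fun a : ↥(pbox M') × Fin (d + 1) => ((a.1, Sum.inl a.2) : Idx M' (Fib d))) (fun t : Res (toSite r) Lc M' => (t.1 : ↥(pbox M')))) k t
        = tdelta M' ((a'.1 : Site (d + 1)) + unitVec a'.2) t.1
          * ((((Lc : ℝ) ^ (d + 1) * stepScale d Lc ℓ)⁻¹)
            * (perF M' (bhKStepAt d (toSite r) Lc ℓ)).submatrix (fun k : κ => ((pμ' k, Sum.inr (mμ' k)) : Idx M' (Fib d)))
                (fun b : ↥(pbox M') × Fin (d + 1) => ((b.1, Sum.inl b.2) : Idx M' (Fib d))) k a') := fun a' =>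
    submatrix_vhSAt_mul_tgrad_of_not_root (M := M') (M' := fun i => M' i / Lc) (fun i => (Nat.mul_div_cancel' (hM' i)).symm) hr ℓ
      (fun k : κ => (pμ' k : Site (d + 1))) (fun k => (pμ' k).2) mμ' (fun t : Res (toSite r) Lc M' => (t.1 : ↥(pbox M')))
      (fun t => (ne_rootOf_iff_proj_ne hL0 (toSite_mem_range hr) _).1 t.2) a'.2 a'.1 k t
  rw [Matrix.sum_mul, Matrix.sum_apply]
  simp only [Matrix.smul_mul, Matrix.smul_apply, smul_eq_mul, key]
  simp only [Matrix.mul_apply, Matrix.of_apply, Finset.mul_sum]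
  exact Finset.sum_congr rfl fun a' _ => by ring

/-- [folklore] **`torus_d1_tower` — (COV-m) ORDER 1: THE TOP STEP's COARSE COVARIANCE ROW `d1` AT EVERY DEPTH.**  With `Dbar := σ_{n+1} • D̄` (`c0`, my g21
`compRows_mul_towerGen_succ`), `Q₂₀` the door's `hQ₂₀` VERBATIM (level `lev 0`, root `rs 0`, presentation `(pμ′, mμ′)`), `D̄₁` from `torus_c1_tower`, and
`Q₂₁ := Σ_{a′} (c·θ_{n+1}·(compRows … (n+1) · h) a′) •` the top step's rooted first-order table `vhSAt (toSite (rs 0)) a′` in the door's presentation —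
the coarse door's insertion jet along the direction TRANSPORTED ONE LEVEL UP, `θ_{n+1} = Lc^{d+1}·stepScale d Lc (lev 0) ∕ σ_{n+1}` (at `n = 0`: U20's `θ_j`):
`Q₂₁ · Dbar + Q₂₀ · D̄₁ = 0` (`sum_smul_vhSAt_mul_tgrad_res`: both terms are `± c • Q₂₀ ·` the tip contact of `compRows · h`). -/
theorem torus_d1_tower (hrs : ∀ k, rs k ∈ box (d + 1) Lc) (hM' : ∀ i, Lc ∣ M' i) (n : ℕ) (c : ℝ)
    (h : ↥(pbox (towerTorus Lc M' (n + 1))) × Fin (d + 1) → ℝ) {κ : Type*} (pμ' : κ → ↥(pbox M')) (mμ' : κ → Fin (d + 1)) :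
    (∑ a' : ↥(pbox M') × Fin (d + 1),
        ((c * (((Lc : ℝ) ^ (d + 1) * stepScale d Lc (lev 0)) * (∏ i ∈ range (n + 1), (stepScale d Lc (lev (i + 1)) * ((box (d + 1) Lc).card : ℝ)))⁻¹))
          * (compRows Lc M' lev rs (n + 1) *ᵥ h) a') •
        (perF M' (dper M' (vhSAt (toSite (rs 0)) d Lc rfl a'.2 (a'.1 : Site (d + 1))))).submatrix (fun k : κ => ((pμ' k, Sum.inr (mμ' k)) : Idx M' (Fib d)))
          (fun b : ↥(pbox M') × Fin (d + 1) => ((b.1, Sum.inl b.2) : Idx M' (Fib d))))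
        * ((∏ i ∈ range (n + 1), (stepScale d Lc (lev (i + 1)) * ((box (d + 1) Lc).card : ℝ))) •
            (tgrad M').submatrix (fun a : ↥(pbox M') × Fin (d + 1) => ((a.1, Sum.inl a.2) : Idx M' (Fib d))) (fun t : Res (toSite (rs 0)) Lc M' => (t.1 : ↥(pbox M'))))
      + (perF M' (bhKStepAt d (toSite (rs 0)) Lc (lev 0))).submatrix (fun a : κ => ((pμ' a, Sum.inr (mμ' a)) : Idx M' (Fib d)))
          (fun b : ↥(pbox M') × Fin (d + 1) => ((b.1, Sum.inl b.2) : Idx M' (Fib d)))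
        * Matrix.of (fun (a : ↥(pbox M') × Fin (d + 1)) (t : Res (toSite (rs 0)) Lc M') =>
            -(c * (compRows Lc M' lev rs (n + 1) *ᵥ h) a * tdelta M' ((a.1 : Site (d + 1)) + unitVec a.2) t.1))
      = 0 := by
  have hB : (box (d + 1) Lc).Nonempty := ⟨rs 0, hrs 0⟩
  have hσ := prod_stepScale_mul_card_ne_zero' Lc hB (fun i => lev (i + 1)) (n + 1)
  have hL : (Lc : ℝ) ^ (d + 1) * stepScale d Lc (lev 0) ≠ 0 := mul_ne_zero (pow_ne_zero _ (by exact_mod_cast NeZero.ne Lc)) (stepScale_ne_zero _)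
  have hθ : (∏ i ∈ range (n + 1), (stepScale d Lc (lev (i + 1)) * ((box (d + 1) Lc).card : ℝ))) * ((Lc : ℝ) ^ (d + 1) * stepScale d Lc (lev 0))⁻¹
      * (c * (((Lc : ℝ) ^ (d + 1) * stepScale d Lc (lev 0)) * (∏ i ∈ range (n + 1), (stepScale d Lc (lev (i + 1)) * ((box (d + 1) Lc).card : ℝ)))⁻¹)) = c := by
    rw [show (∏ i ∈ range (n + 1), (stepScale d Lc (lev (i + 1)) * ((box (d + 1) Lc).card : ℝ))) * ((Lc : ℝ) ^ (d + 1) * stepScale d Lc (lev 0))⁻¹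
        * (c * (((Lc : ℝ) ^ (d + 1) * stepScale d Lc (lev 0)) * (∏ i ∈ range (n + 1), (stepScale d Lc (lev (i + 1)) * ((box (d + 1) Lc).card : ℝ)))⁻¹))
        = c * ((∏ i ∈ range (n + 1), (stepScale d Lc (lev (i + 1)) * ((box (d + 1) Lc).card : ℝ)))
            * (∏ i ∈ range (n + 1), (stepScale d Lc (lev (i + 1)) * ((box (d + 1) Lc).card : ℝ)))⁻¹)
          * (((Lc : ℝ) ^ (d + 1) * stepScale d Lc (lev 0)) * ((Lc : ℝ) ^ (d + 1) * stepScale d Lc (lev 0))⁻¹) by ring,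
      mul_inv_cancel₀ hσ, mul_inv_cancel₀ hL, mul_one, mul_one]
  have e1 : Matrix.of (fun (b : ↥(pbox M') × Fin (d + 1)) (t : Res (toSite (rs 0)) Lc M') =>
        (c * (((Lc : ℝ) ^ (d + 1) * stepScale d Lc (lev 0)) * (∏ i ∈ range (n + 1), (stepScale d Lc (lev (i + 1)) * ((box (d + 1) Lc).card : ℝ)))⁻¹))
          * (compRows Lc M' lev rs (n + 1) *ᵥ h) b * tdelta M' ((b.1 : Site (d + 1)) + unitVec b.2) t.1)
      = (c * (((Lc : ℝ) ^ (d + 1) * stepScale d Lc (lev 0)) * (∏ i ∈ range (n + 1), (stepScale d Lc (lev (i + 1)) * ((box (d + 1) Lc).card : ℝ)))⁻¹)) •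
          Matrix.of (fun (b : ↥(pbox M') × Fin (d + 1)) (t : Res (toSite (rs 0)) Lc M') =>
            (compRows Lc M' lev rs (n + 1) *ᵥ h) b * tdelta M' ((b.1 : Site (d + 1)) + unitVec b.2) t.1) := by
    ext b t; simp only [Matrix.of_apply, Matrix.smul_apply, smul_eq_mul, mul_assoc]
  have e2 : Matrix.of (fun (a : ↥(pbox M') × Fin (d + 1)) (t : Res (toSite (rs 0)) Lc M') =>
        -(c * (compRows Lc M' lev rs (n + 1) *ᵥ h) a * tdelta M' ((a.1 : Site (d + 1)) + unitVec a.2) t.1))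
      = -(c • Matrix.of (fun (b : ↥(pbox M') × Fin (d + 1)) (t : Res (toSite (rs 0)) Lc M') =>
            (compRows Lc M' lev rs (n + 1) *ᵥ h) b * tdelta M' ((b.1 : Site (d + 1)) + unitVec b.2) t.1)) := by
    ext a t; simp only [Matrix.of_apply, Matrix.neg_apply, Matrix.smul_apply, smul_eq_mul, mul_assoc]
  rw [Matrix.mul_smul, sum_smul_vhSAt_mul_tgrad_res (hrs 0) hM' (lev 0) pμ' mμ', e1, e2, Matrix.mul_smul, smul_smul, smul_smul, hθ, Matrix.mul_neg,
    Matrix.mul_smul, add_neg_cancel]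

end Rows

end Summit.QuantumFields.BalabanUV.Beta.FP.TorusCompositeCovarianceOneRows

end
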